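import Literature.MathematicalPhysics.QuantumFieldTheory.Balaban1983to89.Node00.CarriersB8
import Literature.MathematicalPhysics.QuantumFieldTheory.Balaban1983to89.B8CubeMemberZd

/-!
# NODE 00 — the `B8.CubeData` member of record: Proposition 6's cube carriers (director-ym R141 (A); N05 s3b)

[Balaban1985RegularSpaces] = T. Bałaban, *Spaces of regular gauge field configurations on a lattice and gauge fixing conditions*, Commun. Math. Phys.
**99** (1985) 75–102, Sect. F pp. 98–99, Proposition 6.

WHAT THIS MODULE IS.  The located, total-definition member of the abstract Proposition-6 carrier `B8.CubeData` (`Cfg, Cube, idx, sizeM, InA,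
GaugedBound`) at NODE 00's objects, so that `B8.Prop6Printed d L B₁ c₁ cub` — the hypothesis `p6` of `Node00.b8LeafOfRecord_of_knit` and the slot
`ResidB8.cub` of the residual layer (`Node00/CarriersB8`) — reads PRINT'S Proposition 6 at objects:

* `Cfg` := all unitary `𝔸`-valued configurations `U₀` on the bonds of `ℤᵈ` (the `Cfg` of n05-a's `B8LeafModelZd3.zdGF3`), the ambient admissible
  family `{Ω_j}_{j ≤ K}` being n05-a's geometric datum `B8LeafModelZd.ZdIdx` (`η`, `K = i.k`, `i.Ω`); `InA α₀ U₀` := `U₀ ∈ 𝔄_K({Ω_j}, α₀)` (1.7)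
  (`B8Ineq132.InAk`), exactly as `zdGF3.InA` — print p. 99: «we can drop out this condition [(3.35)] from the assumption (1.33)».
* `Cube` := print's cubes `□` of p. 98 (`CubeB8`): a scale index `k` («A size of this cube depends on an index j indicating a scale we are interested in»;
  print's w.l.o.g. «j = k, because we can drop out the domains Ω_{j′}, j′ > j» is the law `k ≤ K`; «we can assume that k ≥ 1»), the lower corner `a` and
  the side `M` of `□^{(k)} = [a, a + M)ᵈ` («a size of □ equal to MLʲη, where M is a multiple of R₁M₁»), `ρ = R₁M₁` with `L ≤ ρ ≤ M`, the (1.130)-step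
  condition `11d < M` (GAPS G-B8-14) and print's implicit `L ≤ dM` (`B8Prop6OfThm4.smallness_134`), «□ ⊂ Ω_j» (`box_sub`) and «□̃ ⊂ Ω_{k−1}» (`tcube_sub`);
  the cubes `{□_j}` of (1.131) with `Ω₀ := □₀`, the restriction tower `ℭ_k` and the gauge data `v` (p. 98), `U₀′ = U₀^{v}`, `U₀″`, `U₁ = U₀″^{u⁻¹}`,
  `A = (1/iη) log U₁` are n05-c's ∕ n05-a's objects BY NAME (`B8Eq131CubesAdmissible.cubeFam false`, `B8CubeMemberZd.cubeLamS`,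
  `B8Eq115GaugeFixing.localGauge`, `B8Ineq133.cutFixed`, `B8LeafModelZd3.mlogCfg`); `idx := k`, `sizeM := M`.
* `GaugedBound U₀ □ r` (`GaugedBoundB8`) := (1.135)–(1.138) with the number `r` in place of `7dL²B₁Mα₀`, keyed VERBATIM to the conclusion letters of
  n05-c's `B8Prop6CubeMember.prop6_asPrinted_cubeMember_of_HFP₄` ((1.29), (1.38) = (1.138) `IsLandau138W` of record at background `1`, (1.135) with
  `w = v⁻¹u`, the (1.62)-shape = (1.135)₂ ∧ (1.136)₁ pointwise on the sides touching `□_j`) and to n05-a's `zdGF3.C136` ∕ `zdGF3.C139` letters at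
  background `1` for (1.136)₂ (`msup (−2)` of `∇^η A`), (1.136)₃,₄ (`bondNorm (−3)` of `∂^{η*}∂^η A`, `Δ^η A`), and (1.137)'s IDENTITY
  `Q_k(ηA) = log Ū₀′ᵏ` on the bonds of `□^{(k)}` in the tree's convention `Q_j(U₀, B) = B7Prop4GeneralLevels.logCovIter` (the factor `i` absorbed, as in
  `zdGF3.C137`), bond letters of `B8Prop6OfThm4.ineq137_cube`.  NOT folded in (located): the uniqueness of `u` (its competitor class is bounded by
  `5dLB₀(L³α₀ + 6dL²Mα₀)`, which carries `α₀`), (1.137)'s INEQUALITIES `|(1/i) log Ū₀′ᵏ(x, x′)| ≤ |x − y|·4α₀ ≤ 2dMα₀` (they carry `α₀`, not `r`: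
  `B8Prop6OfThm4.ineq137_cube` BY NAME), and (1.36)'s Hölder member (print's (1.136) does not list it).

Then `zdCub 𝔸 L i : B8.CubeData` (the member over `ZdIdx`), `cubB8OfRecord θ : IdxB8 θ → B8.CubeData` (the member of record, ambient families with
`Ω₀ = T`), `ResidB8.withCub` (the residual layer with its Proposition-6 slot located), and the `Iff.rfl` faces `gaugedBound_zdCub_iff`,
`prop6Printed_zdCub_iff` (= the `∀`-sentence a kernel lane proves: n05-e's `prop6Printed_body_cubeMember` after one `InAk`-truncation step `c.k ≤ i.k`).

HONEST FRAMING: DEFINITIONS and `rfl` bookkeeping only — nothing of [Balaban1985RegularSpaces] is asserted or discharged here; Proposition 6 at the member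
is n05-c's ∕ n05-e's kernel theorems modulo the knit's four sockets; N05 NOT discharged; counts unmoved; one finite T⁴ programme at fixed ε, Bałaban as
printed — NOT continuum ∕ ℝ⁴ ∕ infinite volume ∕ OS ∕ mass gap ∕ Clay.  No `sorry`, no `axiom`, no `opaque`, no `instance`, no `notation`. -/

noncomputable section

namespace Literature.MathematicalPhysics.QuantumFieldTheory.Balaban1983to89.Node00

open MatrixLog (mlog)
open B7Prop1Explicit B7Prop2Explicit B7Prop1Local B8Ineq130
open B8LeafModelZd (ZdIdx)
open B8LeafModelZd3 (zdGF3 mlogCfg)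
open B8Ineq132 (InAk covDerivFwd)
open B8Ineq133 (cutFixed)
open B8Eq115GaugeFixing (localGauge)
open B8Eq119TwistedAxial (Restr129)
open B8Eq184Proof (cfgExp)
open B8Eq140Level (SideTouches)
open B8Eq138LandauZd (IsLandau138W logCfg covLap)
open B8Eq146AExpansion (iEta plaqCovDeriv)
open B8Eq143PlaqExpansion (pdiv)
open B7Prop4GeneralLevels (logCovIter)
open B8ScaledSupNorm (bondNorm msup)
open B8Eq131Cubes (box tcube tLo tHi ctr bLo bHi)
open B8Eq131CubesAdmissible (cubeFam)
open B8CubeMemberZd (cubeLamS)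

/-! ## §1. Print's cubes `□` inside an ambient admissible family (p. 98) -/

section Cube

variable {d : ℕ}

/-- **A CUBE `□` OF PROPOSITION 6 inside an ambient admissible family `{Ω_j}_{j ≤ K}`** (p. 98): the scale index `k` of `□` («an index j indicating a
scale we are interested in»; print's w.l.o.g. `j = k ≤ K` after dropping `Ω_{j′}`, `j′ > j`, and «we can assume that k ≥ 1»), the cube
`□^{(k)} = [a, a + M)ᵈ` of the `Lᵏη`-lattice («a size of □ equal to MLʲη, where M is a multiple of R₁M₁»), `ρ = R₁M₁` («L⁻¹RM > 2dR₁M₁», here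
`L ≤ ρ ≤ M`), the (1.130)-step condition `11d < M` (GAPS G-B8-14), print's implicit `L ≤ dM`, «□ is contained in Ω_j» and «we have □̃ ⊂ Ω_{k−1}».
The fine-lattice sets `□ = box`, `□̃ = tcube` are n05-a's `B8Eq131Cubes`. [cite: Balaban1985RegularSpaces, p.98 («Now let us take a cube □ ⊂ Ω₀ …»), (1.130) p.99] -/
structure CubeB8 (d L K : ℕ) (Ω : ℕ → Set (B7Prop1Explicit.Site d)) : Type where
  /-- scale index of `□` (print's `j`, renamed `k`) -/
  k : ℕ
  /-- lower corner of `□^{(k)} = [a, a + M)ᵈ` -/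
  a : B7Prop1Explicit.Site d
  /-- side `M` of `□^{(k)}` -/
  M : ℕ
  /-- `ρ = R₁M₁`, the width of the collars `□_j \ □_{j+1}` -/
  ρ : ℕ
  one_le_k : 1 ≤ k
  k_le : k ≤ K
  L_le_ρ : L ≤ ρ
  ρ_le_M : ρ ≤ M
  big : 11 * d < M
  L_le_dM : L ≤ d * M
  /-- «□ ⊂ Ω_j» -/
  box_sub : box L a M k ⊆ Ω k
  /-- «□̃ ⊂ Ω_{k−1}» -/
  tcube_sub : tcube L a M ρ k ⊆ Ω (k - 1)

namespace CubeB8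

variable {L K : ℕ} {Ω : ℕ → Set (B7Prop1Explicit.Site d)} (c : CubeB8 d L K Ω)

/-- The cubes `{□_j}_{j ≤ k}` of (1.131) as an admissible family with `Ω₀ := □₀` (n05-a's `cubeFam false`). [cite: Balaban1985RegularSpaces, (1.131) p.99] -/
abbrev sq : ℕ → Set (B7Prop1Explicit.Site d) := cubeFam false L c.a c.M c.ρ c.k

/-- The restriction tower `ℭ_k = ⋃ Λ′_j` of (1.131) at the top level (n05-c's `cubeLamS … k`). [cite: Balaban1985RegularSpaces, (1.131) p.99] -/
abbrev lamS : ℕ → Set (B7Prop1Explicit.Site d) := cubeLamS L c.a c.M c.ρ c.k c.k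

variable {𝔸 : Type*} [CStarAlgebra 𝔸]

/-- The gauge transformation `v : U₀ ↦ U₀′` of p. 98 (axial gauges (1.15) on `□̃` and the global axial gauge of `Ū₀′ᵏ` at the centre `y` of `□̃^{(k)}`):
n05-a's `B8Eq115GaugeFixing.localGauge`. [cite: Balaban1985RegularSpaces, p.98 («We apply a gauge transformation to U₀ …»)] -/
abbrev vfix (U₀ : B7Prop1Explicit.Site d → Fin d → 𝔸ˣ) : B7Prop1Explicit.Site d → 𝔸ˣ := localGauge L (tLo c.a c.ρ) (tHi c.a c.M c.ρ) U₀ c.k (ctr c.a c.M)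

/-- `U₀′ = U₀^{v}` (p. 98). [cite: Balaban1985RegularSpaces, p.98, (1.129) p.98] -/
abbrev axial (U₀ : B7Prop1Explicit.Site d → Fin d → 𝔸ˣ) : B7Prop1Explicit.Site d → Fin d → 𝔸ˣ := gaugeAct (c.vfix U₀) U₀

/-- `U₀″` := `U₀′` on `□̃`, `1` outside (p. 99): n05-a's `B8Ineq133.cutFixed`. [cite: Balaban1985RegularSpaces, p.99 («a configuration U₀″ as equal to U₀′ on □̃, and equal to 1 outside»)] -/
abbrev dprime (U₀ : B7Prop1Explicit.Site d → Fin d → 𝔸ˣ) : B7Prop1Explicit.Site d → Fin d → 𝔸ˣ := cutFixed L (tLo c.a c.ρ) (tHi c.a c.M c.ρ) U₀ c.k (ctr c.a c.M)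

/-- `U₁ = U₀″^{u⁻¹}` (p. 99, the sentence after (1.133)). [cite: Balaban1985RegularSpaces, p.99] -/
abbrev fixed (U₀ : B7Prop1Explicit.Site d → Fin d → 𝔸ˣ) (u : B7Prop1Explicit.Site d → 𝔸ˣ) : B7Prop1Explicit.Site d → Fin d → 𝔸ˣ := gaugeAct u⁻¹ (c.dprime U₀)

/-- The exponent `A = (1/iη) log U₁` of (1.135), read through n05-a's canonical masked logarithm on the sides touching the `□_j` (`B8LeafModelZd3.mlogCfg`,
the exponent `zdGF3.C136 ∕ C137 ∕ C139` read). [cite: Balaban1985RegularSpaces, (1.135) p.99, (1.36) p.82] -/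
abbrev expo (η : ℝ) (U₀ : B7Prop1Explicit.Site d → Fin d → 𝔸ˣ) (u : B7Prop1Explicit.Site d → 𝔸ˣ) : B7Prop1Explicit.Site d → Fin d → 𝔸 :=
  mlogCfg c.k η c.sq (c.fixed U₀ u)

end CubeB8

end Cube

/-! ## §2. `GaugedBound U₀ □ r` = (1.135)–(1.138) with the number `r` -/

section Gauged

variable {d : ℕ} {𝔸 : Type*} [CStarAlgebra 𝔸]

/-- **(1.135)–(1.138) OF PROPOSITION 6 WITH THE NUMBER `r` IN PLACE OF `7dL²B₁Mα₀`** (p. 99), for an ambient spacing `η`, a configuration `U₀` and a cube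
`□ = c`: «there exists a gauge transformation u defined on □̃» — unitary, `= 1` off `□₀`, restricted (1.29) w.r.t. `ℭ_k` — «such, that U₀^{u⁻¹} = U₁ = e^{iηA}
on □̃ (1.135)» — the Landau gauge of record (1.138) `R ∂^{η*}A = 0` for `U₁ = U₀″^{u⁻¹}` at background `1` («defined without any external gauge field
configuration (or the configuration is equal to 1)»), the exponential form with `A` Hermitian and «Lʲη|A| ≤ r» on the sides touching `□_j` ((1.136)₁), `w = v⁻¹u`
unitary with `U₀^{w⁻¹} = U₁` on the bonds of `□̃` — «(Lʲη)²|∇^η A|, (Lʲη)³|∂^{η*}∂^η A|, (Lʲη)³|Δ^η A| ≤ r on □_j (1.136)» in the scaled sup norms of record,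
and «Q_k(ηA) = (1/i) log Ū₀′ᵏ on □^{(k)} (1.137)» (tree convention: the factor `i` absorbed in `logCovIter`).  Conjunct letters = n05-c's
`B8Prop6CubeMember.prop6_asPrinted_cubeMember_of_HFP₄` and n05-a's `zdGF3.C136 ∕ C139` at background `1`. [cite: Balaban1985RegularSpaces, Prop. 6 (1.135)–(1.138) p.99, (1.29) p.81, (1.38) p.82, (1.62) p.87] -/
def GaugedBoundB8 (L : ℕ) {K : ℕ} {Ω : ℕ → Set (B7Prop1Explicit.Site d)} (η : ℝ) (U₀ : B7Prop1Explicit.Site d → Fin d → 𝔸ˣ) (c : CubeB8 d L K Ω) (r : ℝ) : Prop :=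
  ∃ u : B7Prop1Explicit.Site d → 𝔸ˣ, (∀ x, u x ∈ unitaryUnits 𝔸) ∧ (∀ x, x ∉ c.sq 0 → u x = 1) ∧
    Restr129 L c.k c.lamS (1 : B7Prop1Explicit.Site d → Fin d → 𝔸ˣ) u ∧
    IsLandau138W L c.k η (c.sq 0) c.lamS (1 : B7Prop1Explicit.Site d → Fin d → 𝔸ˣ) (c.fixed U₀ u) ∧
    (∀ j, j ≤ c.k → ∀ b ∈ {b : B7Prop1Explicit.Site d × Fin d | SideTouches (c.sq j) b.1 b.2},
      c.fixed U₀ u b.1 b.2 = cfgExp η (logCfg η (c.fixed U₀ u)) b.1 b.2 ∧ IsSelfAdjoint (logCfg η (c.fixed U₀ u) b.1 b.2) ∧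
        ‖logCfg η (c.fixed U₀ u) b.1 b.2‖ ≤ r * ((L : ℝ) ^ j * η)⁻¹) ∧
    (∀ x, ((c.vfix U₀)⁻¹ * u) x ∈ unitaryUnits 𝔸) ∧
    AgreeOn (tlo L (tLo c.a c.ρ) c.k) (thi L (tHi c.a c.M c.ρ) c.k) (gaugeAct ((c.vfix U₀)⁻¹ * u)⁻¹ U₀) (c.fixed U₀ u) ∧
    msup L c.k η (-(2 : ℝ)) (fun j (t : Fin d × Fin d × B7Prop1Explicit.Site d) => SideTouches (c.sq j) t.2.2 t.2.1)
        (fun t => covDerivFwd η (1 : B7Prop1Explicit.Site d → Fin d → 𝔸ˣ) t.1 (fun z => c.expo η U₀ u z t.2.1) t.2.2) ≤ r ∧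
    bondNorm L c.k η (-(3 : ℝ)) c.sq
        (fun x μ => pdiv η (1 : B7Prop1Explicit.Site d → Fin d → 𝔸ˣ) (plaqCovDeriv η (1 : B7Prop1Explicit.Site d → Fin d → 𝔸ˣ) (c.expo η U₀ u)) μ x) ≤ r ∧
    bondNorm L c.k η (-(3 : ℝ)) c.sq (fun x μ => covLap η (1 : B7Prop1Explicit.Site d → Fin d → 𝔸ˣ) (fun z => c.expo η U₀ u z μ) x) ≤ r ∧
    (∀ (x : B7Prop1Explicit.Site d) (μ : Fin d), bLo L c.a 0 0 ≤ x → x + e μ ≤ bHi L c.a c.M 0 0 →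
      logCovIter L (1 : B7Prop1Explicit.Site d → Fin d → 𝔸ˣ) (iEta η (c.expo η U₀ u)) c.k x μ = mlog ((avgIter L (c.axial U₀) c.k x μ : 𝔸ˣ) : 𝔸))

/-- **KERNEL COHERENCE WITH n05-c's LETTERS** (bookkeeping): the ∃`u`-body of `B8Prop6CubeMember.prop6_asPrinted_cubeMember_of_HFP₄` at the cube datum
`(η, c.k, c.a, c.M, c.ρ)` with the number `r` — written in its RAW letters (`cubeFam false`, `cubeLamS`, `cutFixed`, `localGauge`) and WITHOUT its
uniqueness clause — together with (1.136)₂–₄ in `zdGF3.C136 ∕ C139` letters at background `1` and (1.137)'s identity in `B8Prop6OfThm4.ineq137_cube`'s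
bond letters, IS `GaugedBoundB8 L η U₀ c r` (anonymous constructor; every abbreviation of this module unfolds by `rfl`). [cite: Balaban1985RegularSpaces, Prop. 6 (1.135)–(1.138) p.99] -/
theorem gaugedBoundB8_intro (L : ℕ) {K : ℕ} {Ω : ℕ → Set (B7Prop1Explicit.Site d)} (η : ℝ) (U₀ : B7Prop1Explicit.Site d → Fin d → 𝔸ˣ)
    (c : CubeB8 d L K Ω) (r : ℝ) (u : B7Prop1Explicit.Site d → 𝔸ˣ) (hu : ∀ x, u x ∈ unitaryUnits 𝔸)
    (huS : ∀ x, x ∉ cubeFam false L c.a c.M c.ρ c.k 0 → u x = 1)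
    (h129 : Restr129 L c.k (cubeLamS L c.a c.M c.ρ c.k c.k) (1 : B7Prop1Explicit.Site d → Fin d → 𝔸ˣ) u)
    (h138 : IsLandau138W L c.k η (cubeFam false L c.a c.M c.ρ c.k 0) (cubeLamS L c.a c.M c.ρ c.k c.k) (1 : B7Prop1Explicit.Site d → Fin d → 𝔸ˣ)
      (gaugeAct u⁻¹ (cutFixed L (tLo c.a c.ρ) (tHi c.a c.M c.ρ) U₀ c.k (ctr c.a c.M))))
    (h162 : ∀ j, j ≤ c.k → ∀ b ∈ {b : B7Prop1Explicit.Site d × Fin d | SideTouches (cubeFam false L c.a c.M c.ρ c.k j) b.1 b.2},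
      gaugeAct u⁻¹ (cutFixed L (tLo c.a c.ρ) (tHi c.a c.M c.ρ) U₀ c.k (ctr c.a c.M)) b.1 b.2 =
          cfgExp η (logCfg η (gaugeAct u⁻¹ (cutFixed L (tLo c.a c.ρ) (tHi c.a c.M c.ρ) U₀ c.k (ctr c.a c.M)))) b.1 b.2 ∧
        IsSelfAdjoint (logCfg η (gaugeAct u⁻¹ (cutFixed L (tLo c.a c.ρ) (tHi c.a c.M c.ρ) U₀ c.k (ctr c.a c.M))) b.1 b.2) ∧
        ‖logCfg η (gaugeAct u⁻¹ (cutFixed L (tLo c.a c.ρ) (tHi c.a c.M c.ρ) U₀ c.k (ctr c.a c.M))) b.1 b.2‖ ≤ r * ((L : ℝ) ^ j * η)⁻¹)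
    (hw : ∀ x, ((localGauge L (tLo c.a c.ρ) (tHi c.a c.M c.ρ) U₀ c.k (ctr c.a c.M))⁻¹ * u) x ∈ unitaryUnits 𝔸)
    (h135 : AgreeOn (tlo L (tLo c.a c.ρ) c.k) (thi L (tHi c.a c.M c.ρ) c.k)
      (gaugeAct ((localGauge L (tLo c.a c.ρ) (tHi c.a c.M c.ρ) U₀ c.k (ctr c.a c.M))⁻¹ * u)⁻¹ U₀)
      (gaugeAct u⁻¹ (cutFixed L (tLo c.a c.ρ) (tHi c.a c.M c.ρ) U₀ c.k (ctr c.a c.M))))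
    (h136₂ : msup L c.k η (-(2 : ℝ)) (fun j (t : Fin d × Fin d × B7Prop1Explicit.Site d) => SideTouches (cubeFam false L c.a c.M c.ρ c.k j) t.2.2 t.2.1)
      (fun t => covDerivFwd η (1 : B7Prop1Explicit.Site d → Fin d → 𝔸ˣ) t.1
        (fun z => mlogCfg c.k η (cubeFam false L c.a c.M c.ρ c.k) (gaugeAct u⁻¹ (cutFixed L (tLo c.a c.ρ) (tHi c.a c.M c.ρ) U₀ c.k (ctr c.a c.M))) z t.2.1)
        t.2.2) ≤ r)
    (h136₃ : bondNorm L c.k η (-(3 : ℝ)) (cubeFam false L c.a c.M c.ρ c.k)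
      (fun x μ => pdiv η (1 : B7Prop1Explicit.Site d → Fin d → 𝔸ˣ) (plaqCovDeriv η (1 : B7Prop1Explicit.Site d → Fin d → 𝔸ˣ)
        (mlogCfg c.k η (cubeFam false L c.a c.M c.ρ c.k) (gaugeAct u⁻¹ (cutFixed L (tLo c.a c.ρ) (tHi c.a c.M c.ρ) U₀ c.k (ctr c.a c.M))))) μ x) ≤ r)
    (h136₄ : bondNorm L c.k η (-(3 : ℝ)) (cubeFam false L c.a c.M c.ρ c.k)
      (fun x μ => covLap η (1 : B7Prop1Explicit.Site d → Fin d → 𝔸ˣ)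
        (fun z => mlogCfg c.k η (cubeFam false L c.a c.M c.ρ c.k) (gaugeAct u⁻¹ (cutFixed L (tLo c.a c.ρ) (tHi c.a c.M c.ρ) U₀ c.k (ctr c.a c.M))) z μ) x) ≤ r)
    (h137 : ∀ (x : B7Prop1Explicit.Site d) (μ : Fin d), bLo L c.a 0 0 ≤ x → x + e μ ≤ bHi L c.a c.M 0 0 →
      logCovIter L (1 : B7Prop1Explicit.Site d → Fin d → 𝔸ˣ)
          (iEta η (mlogCfg c.k η (cubeFam false L c.a c.M c.ρ c.k) (gaugeAct u⁻¹ (cutFixed L (tLo c.a c.ρ) (tHi c.a c.M c.ρ) U₀ c.k (ctr c.a c.M))))) c.k x μ =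
        mlog ((avgIter L (gaugeAct (localGauge L (tLo c.a c.ρ) (tHi c.a c.M c.ρ) U₀ c.k (ctr c.a c.M)) U₀) c.k x μ : 𝔸ˣ) : 𝔸)) :
    GaugedBoundB8 L η U₀ c r :=
  ⟨u, hu, huS, h129, h138, h162, hw, h135, h136₂, h136₃, h136₄, h137⟩

/-- … and conversely `GaugedBoundB8` hands back the gauge transformation with the eleven clauses (bookkeeping). [cite: Balaban1985RegularSpaces, Prop. 6 (1.135)–(1.138) p.99] -/
theorem gaugedBoundB8_iff (L : ℕ) {K : ℕ} {Ω : ℕ → Set (B7Prop1Explicit.Site d)} (η : ℝ) (U₀ : B7Prop1Explicit.Site d → Fin d → 𝔸ˣ)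
    (c : CubeB8 d L K Ω) (r : ℝ) :
    GaugedBoundB8 L η U₀ c r ↔ ∃ u : B7Prop1Explicit.Site d → 𝔸ˣ, (∀ x, u x ∈ unitaryUnits 𝔸) ∧ (∀ x, x ∉ c.sq 0 → u x = 1) ∧
      Restr129 L c.k c.lamS (1 : B7Prop1Explicit.Site d → Fin d → 𝔸ˣ) u ∧
      IsLandau138W L c.k η (c.sq 0) c.lamS (1 : B7Prop1Explicit.Site d → Fin d → 𝔸ˣ) (c.fixed U₀ u) ∧
      (∀ j, j ≤ c.k → ∀ b ∈ {b : B7Prop1Explicit.Site d × Fin d | SideTouches (c.sq j) b.1 b.2},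
        c.fixed U₀ u b.1 b.2 = cfgExp η (logCfg η (c.fixed U₀ u)) b.1 b.2 ∧ IsSelfAdjoint (logCfg η (c.fixed U₀ u) b.1 b.2) ∧
          ‖logCfg η (c.fixed U₀ u) b.1 b.2‖ ≤ r * ((L : ℝ) ^ j * η)⁻¹) ∧
      (∀ x, ((c.vfix U₀)⁻¹ * u) x ∈ unitaryUnits 𝔸) ∧
      AgreeOn (tlo L (tLo c.a c.ρ) c.k) (thi L (tHi c.a c.M c.ρ) c.k) (gaugeAct ((c.vfix U₀)⁻¹ * u)⁻¹ U₀) (c.fixed U₀ u) ∧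
      msup L c.k η (-(2 : ℝ)) (fun j (t : Fin d × Fin d × B7Prop1Explicit.Site d) => SideTouches (c.sq j) t.2.2 t.2.1)
          (fun t => covDerivFwd η (1 : B7Prop1Explicit.Site d → Fin d → 𝔸ˣ) t.1 (fun z => c.expo η U₀ u z t.2.1) t.2.2) ≤ r ∧
      bondNorm L c.k η (-(3 : ℝ)) c.sq
          (fun x μ => pdiv η (1 : B7Prop1Explicit.Site d → Fin d → 𝔸ˣ) (plaqCovDeriv η (1 : B7Prop1Explicit.Site d → Fin d → 𝔸ˣ) (c.expo η U₀ u)) μ x) ≤ r ∧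
      bondNorm L c.k η (-(3 : ℝ)) c.sq (fun x μ => covLap η (1 : B7Prop1Explicit.Site d → Fin d → 𝔸ˣ) (fun z => c.expo η U₀ u z μ) x) ≤ r ∧
      (∀ (x : B7Prop1Explicit.Site d) (μ : Fin d), bLo L c.a 0 0 ≤ x → x + e μ ≤ bHi L c.a c.M 0 0 →
        logCovIter L (1 : B7Prop1Explicit.Site d → Fin d → 𝔸ˣ) (iEta η (c.expo η U₀ u)) c.k x μ = mlog ((avgIter L (c.axial U₀) c.k x μ : 𝔸ˣ) : 𝔸)) :=
  Iff.rfl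

/-- `𝔄_{K}({Ω_j}, α₀) ⊂ 𝔄_k({Ω_j}_{j ≤ k}, α₀)` for `k ≤ K` — print's «we can drop out the domains Ω_{j′}, j′ > j, from our assumptions» (p. 98); the
pattern of `B8Thm4TruncationLocal.inAk_truncate`. [cite: Balaban1985RegularSpaces, p.98 («we can drop out the domains Ω_{j′}, j′ > j»)] -/
theorem inAk_of_le {𝔹 : Type*} [NormedRing 𝔹] [NormedAlgebra ℂ 𝔹] {L k K : ℕ} (hk : k ≤ K) {η α : ℝ} {Ω : ℕ → Set (B7Prop1Explicit.Site d)}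
    {V : B7Prop1Explicit.Site d → Fin d → 𝔹ˣ} (h : InAk L K η α Ω V) : InAk L k η α Ω V :=
  fun j hj => h j (hj.trans hk)

/-- At a cube `c` of the member, the ambient hypothesis `U₀ ∈ 𝔄_K({Ω_j}, α₀)` gives `U₀ ∈ 𝔄_{c.k}({Ω_j}, α₀)` (`c.k_le`). [cite: Balaban1985RegularSpaces, p.98] -/
theorem CubeB8.inAk {𝔹 : Type*} [NormedRing 𝔹] [NormedAlgebra ℂ 𝔹] {L K : ℕ} {Ω : ℕ → Set (B7Prop1Explicit.Site d)} (c : CubeB8 d L K Ω) {η α : ℝ}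
    {V : B7Prop1Explicit.Site d → Fin d → 𝔹ˣ} (h : InAk L K η α Ω V) : InAk L c.k η α Ω V :=
  inAk_of_le c.k_le h

end Gauged

/-! ## §3. The member `zdCub` over `ZdIdx`, the member of record, the located residual layer -/

section Member

variable {d : ℕ} (𝔸 : Type) [CStarAlgebra 𝔸] (L : ℕ)

/-- **THE `B8.CubeData` MEMBER over n05-a's geometric datum `i : ZdIdx d L`** (ambient family `{Ω_j}_{j ≤ i.k}`, spacing `i.η`): `Cfg` and `InA` as in
`B8LeafModelZd3.zdGF3` (all unitary configurations; `𝔄_k({Ω_j}, α₀)` — (3.35) dropped, p. 99), `Cube := CubeB8 d L i.k i.Ω`, `idx := k`, `sizeM := M`,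
`GaugedBound := GaugedBoundB8 L i.η`. [cite: Balaban1985RegularSpaces, Prop. 6 p.99, p.98, p.99 («we can drop out this condition from the assumption (1.33)»)] -/
def zdCub (i : ZdIdx d L) : B8.CubeData where
  Cfg := {U : B7Prop1Explicit.Site d → Fin d → 𝔸ˣ // ∀ x κ, U x κ ∈ unitaryUnits 𝔸}
  Cube := CubeB8 d L i.k i.Ω
  idx := fun c => c.k
  sizeM := fun c => (c.M : ℝ)
  InA := fun α₀ U₀ => InAk L i.k i.η α₀ i.Ω U₀.1
  GaugedBound := fun U₀ c r => GaugedBoundB8 L i.η U₀.1 c r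

variable {𝔸 L}

/-- The configurations of the member: all unitary configurations on the bonds of `ℤᵈ`. [cite: Balaban1985RegularSpaces, Prop. 6 p.99] -/
theorem zdCub_Cfg (i : ZdIdx d L) : (zdCub 𝔸 L i).Cfg = {U : B7Prop1Explicit.Site d → Fin d → 𝔸ˣ // ∀ x κ, U x κ ∈ unitaryUnits 𝔸} := rfl

/-- The cubes of the member: `CubeB8 d L i.k i.Ω`. [cite: Balaban1985RegularSpaces, p.98, Prop. 6 p.99] -/
theorem zdCub_Cube (i : ZdIdx d L) : (zdCub 𝔸 L i).Cube = CubeB8 d L i.k i.Ω := rfl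

/-- `zdCub` and `zdGF3` have the same configurations. [cite: Balaban1985RegularSpaces, Prop. 6 p.99] -/
theorem zdCub_Cfg_eq_zdGF3 (β : ℝ) (len : B7Prop1Explicit.Site d → ℝ) (i : ZdIdx d L) : (zdCub 𝔸 L i).Cfg = (zdGF3 𝔸 L β len i).Cfg := rfl

/-- `idx` reads the scale index `k` of `□` (print's `j`). [cite: Balaban1985RegularSpaces, p.98, Prop. 6 p.99] -/
theorem zdCub_idx (i : ZdIdx d L) (c : (zdCub 𝔸 L i).Cube) : (zdCub 𝔸 L i).idx c = c.k := rfl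

/-- `sizeM` reads the side `M` of `□^{(k)}`. [cite: Balaban1985RegularSpaces, p.98, Prop. 6 p.99] -/
theorem zdCub_sizeM (i : ZdIdx d L) (c : (zdCub 𝔸 L i).Cube) : (zdCub 𝔸 L i).sizeM c = (c.M : ℝ) := rfl

/-- `InA α₀ U₀` reads `U₀ ∈ 𝔄_k({Ω_j}, α₀)` (1.7). [cite: Balaban1985RegularSpaces, (1.7) p.77, Prop. 6 p.99] -/
theorem inA_zdCub_iff (i : ZdIdx d L) (α₀ : ℝ) (U₀ : (zdCub 𝔸 L i).Cfg) : (zdCub 𝔸 L i).InA α₀ U₀ ↔ InAk L i.k i.η α₀ i.Ω U₀.1 := Iff.rfl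

/-- `zdCub` and `zdGF3` read `U₀ ∈ 𝔄_k({Ω_j}, α₀)` identically. [cite: Balaban1985RegularSpaces, (1.7) p.77, (1.33) p.82] -/
theorem inA_zdCub_iff_zdGF3 (β : ℝ) (len : B7Prop1Explicit.Site d → ℝ) (i : ZdIdx d L) (α₀ : ℝ) (U₀ : (zdCub 𝔸 L i).Cfg) :
    (zdCub 𝔸 L i).InA α₀ U₀ ↔ (zdGF3 𝔸 L β len i).InA α₀ U₀ := Iff.rfl

/-- `GaugedBound` of the member is `GaugedBoundB8 L i.η` = (1.135)–(1.138) with the number `r`. [cite: Balaban1985RegularSpaces, Prop. 6 p.99] -/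
theorem gaugedBound_zdCub_iff (i : ZdIdx d L) (U₀ : (zdCub 𝔸 L i).Cfg) (c : (zdCub 𝔸 L i).Cube) (r : ℝ) :
    (zdCub 𝔸 L i).GaugedBound U₀ c r ↔ GaugedBoundB8 L i.η U₀.1 c r := Iff.rfl

/-- **`B8.Prop6Printed` ON THE MEMBER, UNFOLDED** — the `∀`-sentence a kernel lane proves (modulo the knit's sockets): for every index `ι`, every `α₀ > 0`,
every unitary `U₀ ∈ 𝔄_{K}({Ω_j}, α₀)` (`K = (f ι).k`) and every cube `c` with «7dL²Mα₀ ≤ c₁», (1.135)–(1.138) with `7dL²B₁Mα₀`.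
[cite: Balaban1985RegularSpaces, Prop. 6 p.99] -/
theorem prop6Printed_zdCub_iff {ι : Type} (f : ι → ZdIdx d L) (B₁ c₁ : ℝ) :
    B8.Prop6Printed d (L : ℝ) B₁ c₁ (fun j => zdCub 𝔸 L (f j)) ↔
      ∀ j : ι, ∀ α₀ : ℝ, 0 < α₀ → ∀ U₀ : {U : B7Prop1Explicit.Site d → Fin d → 𝔸ˣ // ∀ x κ, U x κ ∈ unitaryUnits 𝔸},
        InAk L (f j).k (f j).η α₀ (f j).Ω U₀.1 → ∀ c : CubeB8 d L (f j).k (f j).Ω, 7 * d * (L : ℝ) ^ 2 * c.M * α₀ ≤ c₁ →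
          GaugedBoundB8 L (f j).η U₀.1 c (7 * d * (L : ℝ) ^ 2 * B₁ * c.M * α₀) := Iff.rfl

end Member

section Record

variable (θ : Stage3Params)

/-- **THE `B8.CubeData` MEMBER OF RECORD**: over print's admitted family index `IdxB8 θ` (ambient families with `Ω₀ = T`), member `i ↦ zdCub θ.𝔸 θ.L i.1` — the
coefficient algebra and block size of the Stage-2 group of record, as `famB8OfRecord`. [cite: Balaban1985RegularSpaces, Prop. 6 p.99, p.77 («we admit Ω_j = T_η»)] -/
def cubB8OfRecord (i : IdxB8 θ) : B8.CubeData :=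
  zdCub θ.𝔸 θ.L i.1

variable {θ}

/-- The member of record at `i` is `zdCub θ.𝔸 θ.L i.1`. [cite: Balaban1985RegularSpaces, Prop. 6 p.99] -/
theorem cubB8OfRecord_eq (i : IdxB8 θ) : cubB8OfRecord θ i = zdCub θ.𝔸 θ.L i.1 := rfl

/-- The member of record and the gauge-fixing family of record have the same configurations. [cite: Balaban1985RegularSpaces, Prop. 6 p.99] -/
theorem cubB8OfRecord_Cfg (β : ℝ) (len : B7Prop1Explicit.Site θ.D → ℝ) (i : IdxB8 θ) : (cubB8OfRecord θ i).Cfg = (famB8OfRecord θ β len i).Cfg := rfl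

/-- … and read `U₀ ∈ 𝔄_k({Ω_j}, α₀)` identically. [cite: Balaban1985RegularSpaces, (1.7) p.77, (1.33) p.82] -/
theorem inA_cubB8OfRecord_iff (β : ℝ) (len : B7Prop1Explicit.Site θ.D → ℝ) (i : IdxB8 θ) (α₀ : ℝ) (U₀ : (cubB8OfRecord θ i).Cfg) :
    (cubB8OfRecord θ i).InA α₀ U₀ ↔ (famB8OfRecord θ β len i).InA α₀ U₀ := Iff.rfl

/-- **THE RESIDUAL LAYER WITH ITS PROPOSITION-6 SLOT LOCATED**: `I8d := IdxB8 θ`, `cub := cubB8OfRecord θ`; every other residual datum unchanged.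
[cite: Balaban1985RegularSpaces, Prop. 6 p.99] -/
def ResidB8.withCub (lam : ResidB8 θ) : ResidB8 θ :=
  { lam with I8d := IdxB8 θ, cub := cubB8OfRecord θ }

/-- The located layer's Proposition-6 index is `IdxB8 θ`. [cite: Balaban1985RegularSpaces, Prop. 6 p.99] -/
theorem ResidB8.withCub_I8d (lam : ResidB8 θ) : lam.withCub.I8d = IdxB8 θ := rfl
/-- The located layer's Proposition-6 members are `cubB8OfRecord θ`. [cite: Balaban1985RegularSpaces, Prop. 6 p.99] -/
theorem ResidB8.withCub_cub (lam : ResidB8 θ) : lam.withCub.cub = cubB8OfRecord θ := rfl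
/-- Locating the Proposition-6 slot leaves the Hölder exponent unchanged. [cite: Balaban1985RegularSpaces, Thm 2 p.83, Prop. 6 p.99] -/
theorem ResidB8.withCub_β (lam : ResidB8 θ) : lam.withCub.β = lam.β := rfl
/-- … and the length function of [4] (3.40). [cite: Balaban1985RegularSpaces, Thm 2 p.83, Prop. 6 p.99] -/
theorem ResidB8.withCub_len (lam : ResidB8 θ) : lam.withCub.len = lam.len := rfl
/-- … and the Proposition-5 index. [cite: Balaban1985RegularSpaces, Prop. 5 p.94, Prop. 6 p.99] -/
theorem ResidB8.withCub_I8c (lam : ResidB8 θ) : lam.withCub.I8c = lam.I8c := rfl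
/-- … and the [Balaban1985BackgroundPropagators] inputs `B₀, B₀′`. [cite: Balaban1985RegularSpaces, Prop. 6 p.99] -/
theorem ResidB8.withCub_inp (lam : ResidB8 θ) : lam.withCub.inp = lam.inp := rfl
/-- … and the constant `B₁` of (1.136). [cite: Balaban1985RegularSpaces, Prop. 6 (1.136) p.99] -/
theorem ResidB8.withCub_B₁ (lam : ResidB8 θ) : lam.withCub.B₁ = lam.B₁ := rfl
/-- … and the threshold `c₁` of «7dL²Mα₀ ≤ c₁». [cite: Balaban1985RegularSpaces, Prop. 6 p.99] -/
theorem ResidB8.withCub_c₁ (lam : ResidB8 θ) : lam.withCub.c₁ = lam.c₁ := rfl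
/-- Locating the slot is idempotent. [cite: Balaban1985RegularSpaces, Prop. 6 p.99] -/
theorem ResidB8.withCub_withCub (lam : ResidB8 θ) : lam.withCub.withCub = lam.withCub := rfl

/-- **WHAT `p6` OF `b8LeafOfRecord_of_knit` READS AT THE LOCATED LAYER**: `B8.Prop6Printed θ.D θ.L lam.B₁ lam.c₁ lam.withCub.cub` is the unfolded
`∀`-sentence over `IdxB8 θ`. [cite: Balaban1985RegularSpaces, Prop. 6 p.99] -/
theorem prop6Printed_withCub_iff (lam : ResidB8 θ) :
    B8.Prop6Printed θ.D (θ.L : ℝ) lam.withCub.B₁ lam.withCub.c₁ lam.withCub.cub ↔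
      ∀ i : IdxB8 θ, ∀ α₀ : ℝ, 0 < α₀ → ∀ U₀ : {U : B7Prop1Explicit.Site θ.D → Fin θ.D → θ.𝔸ˣ // ∀ x κ, U x κ ∈ unitaryUnits θ.𝔸},
        InAk θ.L i.1.k i.1.η α₀ i.1.Ω U₀.1 → ∀ c : CubeB8 θ.D θ.L i.1.k i.1.Ω, 7 * θ.D * (θ.L : ℝ) ^ 2 * c.M * α₀ ≤ lam.c₁ →
          GaugedBoundB8 θ.L i.1.η U₀.1 c (7 * θ.D * (θ.L : ℝ) ^ 2 * lam.B₁ * c.M * α₀) := Iff.rfl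

end Record

/-! ## §4. Non-vacuity bookkeeping: cubes exist inside a family whose levels `k − 1`, `k` are the whole lattice -/

section NonVacuity

variable {d : ℕ}

/-- In an ambient family with `Ω_k = Ω_{k−1} = T` (e.g. the all-torus members of n05-a's `B8LeafModelZd3NonVacuity`), every cube datum with print's size laws
is a cube of Proposition 6 («□ ⊂ Ω_j», «□̃ ⊂ Ω_{k−1}» automatic). [cite: Balaban1985RegularSpaces, p.98 («Now let us take a cube □ ⊂ Ω₀ …»)] -/
def CubeB8.ofUniv {L K : ℕ} {Ω : ℕ → Set (B7Prop1Explicit.Site d)} (k : ℕ) (a : B7Prop1Explicit.Site d) (M ρ : ℕ) (hk : 1 ≤ k) (hkK : k ≤ K) (hLρ : L ≤ ρ) (hρM : ρ ≤ M)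
    (hbig : 11 * d < M) (hLdM : L ≤ d * M) (hΩ : Ω k = Set.univ) (hΩ' : Ω (k - 1) = Set.univ) : CubeB8 d L K Ω :=
  ⟨k, a, M, ρ, hk, hkK, hLρ, hρM, hbig, hLdM, by rw [hΩ]; exact Set.subset_univ _, by rw [hΩ']; exact Set.subset_univ _⟩

/-- The cube `ofUniv` has the prescribed scale index. [cite: Balaban1985RegularSpaces, p.98, Prop. 6 p.99] -/
theorem CubeB8.ofUniv_k {L K : ℕ} {Ω : ℕ → Set (B7Prop1Explicit.Site d)} (k : ℕ) (a : B7Prop1Explicit.Site d) (M ρ : ℕ) (hk : 1 ≤ k) (hkK : k ≤ K) (hLρ : L ≤ ρ) (hρM : ρ ≤ M)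
    (hbig : 11 * d < M) (hLdM : L ≤ d * M) (hΩ : Ω k = Set.univ) (hΩ' : Ω (k - 1) = Set.univ) :
    (CubeB8.ofUniv k a M ρ hk hkK hLρ hρM hbig hLdM hΩ hΩ').k = k := rfl

/-- The cube `ofUniv` has the prescribed side. [cite: Balaban1985RegularSpaces, p.98, Prop. 6 p.99] -/
theorem CubeB8.ofUniv_M {L K : ℕ} {Ω : ℕ → Set (B7Prop1Explicit.Site d)} (k : ℕ) (a : B7Prop1Explicit.Site d) (M ρ : ℕ) (hk : 1 ≤ k) (hkK : k ≤ K) (hLρ : L ≤ ρ) (hρM : ρ ≤ M)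
    (hbig : 11 * d < M) (hLdM : L ≤ d * M) (hΩ : Ω k = Set.univ) (hΩ' : Ω (k - 1) = Set.univ) :
    (CubeB8.ofUniv k a M ρ hk hkK hLρ hρM hbig hLdM hΩ hΩ').M = M := rfl

/-- **THE CUBE TYPE IS INHABITED** over any ambient family with `Ω_K = Ω_{K−1} = T`, `K ≥ 1`, `d, L ≥ 1`: the cube at scale `K`, corner `0`,
`ρ := L`, side `M := max L (11d + 1)`. [cite: Balaban1985RegularSpaces, p.98 («To prove condition (3.35) it is enough to take one such cube»)] -/
theorem CubeB8.nonempty_of_univ {L K : ℕ} {Ω : ℕ → Set (B7Prop1Explicit.Site d)} (hd : 1 ≤ d) (hK : 1 ≤ K) (hΩ : Ω K = Set.univ) (hΩ' : Ω (K - 1) = Set.univ) :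
    Nonempty (CubeB8 d L K Ω) :=
  ⟨CubeB8.ofUniv K 0 (max L (11 * d + 1)) L hK le_rfl le_rfl (le_max_left _ _) (Nat.lt_of_lt_of_le (Nat.lt_succ_self _) (le_max_right _ _))
    ((le_max_left _ _).trans (le_mul_of_one_le_left (Nat.zero_le _) hd)) hΩ hΩ'⟩

end NonVacuity

end Literature.MathematicalPhysics.QuantumFieldTheory.Balaban1983to89.Node00

end
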